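import Mathlib
import HarnessLib.Audit
import Summits.PneNP.PneNP.Theorems.PstarFreshErase
import Summits.PneNP.PneNP.Theorems.PstarGSystemFreeVar

/-!
# Fresh gates are erasable, II: erasing the gate keeps the core terminal (ROUND-24, memo §14.3; ASK T-O2-F «FreshErase» (2))

FRONTIER range-avoidance ladder, rung F-N3, ROUND 24 (cell `pnp-ideate`, planner memo `r24/CORE-BOUND-NOTES.md` §14.3, ASK T-O2-F of planner p3 g21,
typed sketch `r24/SketchFreshErase.lean` statement (2) verbatim; restricted-model proof complexity — nothing here bears on `P` versus `NP`).

`terminal_eraseGate`: a TERMINAL core `J₀` (`PstarCoreBoundTargets.Terminal`) with a fresh single-use gate `g = (p, z)` of `w₁` on an AND variable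
`p` of a CLEAN output `e ∈ J₀` whose AND pair no other monomial of `w₁, w₂` touches stays terminal when the gate is erased.  (T3) is
`PstarFreshErase.t3_fresh_split`; (M0) at `f ≠ e` keeps its witness (the pin `pin_of_freshGate` switches the gate off there); (M0) at `e`: the
privates `p, p′` of `e` are free on `Sol(J₀ ∖ e)` and move `(w₁′, w₂)` linearly — if no flip of the original witness works, then either no private is
read by `w₂` (and the lifted witness contradicts the pin), or flipping a private read by `w₂` shows that `w₁′` resp. `w₁′ + w₂` misses its target on
`Sol(J₀ ∖ e)`, so it is CONSTANT by `PstarGSat.gSat` — contradicting the gate-off witness of another output `f ≠ e` (which exists: `J₀` is XOR-closed).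

COROLLARY (induction on the number of such gates, for the planner): fresh single-use gates on clean otherwise-untouched outputs are erasable one by
one; if they are the only violations of privates-unread, `card_le_five_of_terminal'` bounds the core by five.
-/

set_option linter.dupNamespace false -- `Summit.PneNP.PneNP.…`: summit = sub-problem name (D-0017 single-conjunct layout)

open Finset Literature.Computability.Complexity
open scoped symmDiff
open Summit.PneNP.PneNP.Theorems.PstarFibrePolys (bit bit_injective)
open Summit.PneNP.PneNP.Theorems.PstarTyped (Typed)
open Summit.PneNP.PneNP.Theorems.PstarSALevel (varSet bdry BoundaryExpanding SimpleOverlap)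
open Summit.PneNP.PneNP.Theorems.PstarGapPeeling (not_mem_varSet_of_private eval_update_of_not_mem)
open Summit.PneNP.PneNP.Theorems.PstarCentreFree (vars_mem_varSet)
open Summit.PneNP.PneNP.Theorems.PstarGapOneAll (gval)
open Summit.PneNP.PneNP.Theorems.PstarCoreBound (XorClosed)
open Summit.PneNP.PneNP.Theorems.PstarChordRepair (IsChord)
open Summit.PneNP.PneNP.Theorems.PstarCoreBoundTargets (Terminal)
open Summit.PneNP.PneNP.Theorems.PstarGSat (gSat)
open Summit.PneNP.PneNP.Theorems.PstarGSystemFreeVar (gval_symmDiff)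
open Summit.PneNP.PneNP.Theorems.PstarFreshErase

namespace Summit.PneNP.PneNP.Theorems.PstarFreshEraseTerminal

variable {n m : ℕ}

/-! ## Tools -/

/-- An XOR-closed family is not a single output: there is another output besides `e`. -/
theorem exists_ne_of_xorClosed (I : LocalMap 4 n m) {J₀ : Finset (Fin m)} (hX : XorClosed I J₀) {e : Fin m} (he : e ∈ J₀) :
    ∃ f ∈ J₀, f ≠ e := by
  classical
  by_contra h
  push Not at h
  have hJ : J₀ = {e} := eq_singleton_iff_unique_mem.2 ⟨he, h⟩
  refine hX e he 0 (by decide) ?_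
  unfold PstarSALevel.bdry
  refine mem_filter.2 ⟨mem_univ _, ?_⟩
  rw [hJ, filter_singleton, if_pos (vars_mem_varSet I e 0), card_singleton]

/-! ## The erasure theorem -/

/-- **(2) FRESH ERASE.**  If the gated variable `p` is an AND variable of a CLEAN output `e ∈ J₀` (both AND variables of `e` on the boundary of
`J₀`) and no other monomial output of `w₁, w₂` touches the AND variables of `e`, then erasing the gate keeps the core terminal. -/
theorem terminal_eraseGate {r : ℕ} (I : LocalMap 4 n m) (hI : I.IsPure xorAndPred) (hT : Typed I) (hS : SimpleOverlap I)
    (hB : BoundaryExpanding r I) {y : Fin m → Bool} {J₀ : Finset (Fin m)} {w₁ w₂ : Finset (Fin n) × Finset (Fin m) × Bool}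
    {g e : Fin m} {p z : Fin n} (hF : FreshGate I J₀ w₁ w₂ g p z) (he : e ∈ J₀) (hpe : I.vars e 2 = p ∨ I.vars e 3 = p)
    (hne : I.vars e 2 ≠ I.vars e 3) (hclean : IsChord I J₀ e)
    (halone : ∀ g' ∈ w₁.2.1 ∪ w₂.2.1, g' ≠ g → ∀ s : Fin 4, 2 ≤ s.val → I.vars g' s ≠ I.vars e 2 ∧ I.vars g' s ≠ I.vars e 3)
    (ht : Terminal I r y J₀ w₁ w₂) : Terminal I r y J₀ (eraseGate w₁ g) w₂ := by
  classical
  -- the hypotheses of the pin (monomials of `w₂` off the AND pair of `e`)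
  have halone₂ : ∀ g' ∈ w₂.2.1, ∀ s : Fin 4, 2 ≤ s.val → I.vars g' s ≠ I.vars e 2 ∧ I.vars g' s ≠ I.vars e 3 :=
    fun g' hg' s hs => halone g' (mem_union_right _ hg') (fun h => hF.2.1 (h ▸ hg')) s hs
  have hpin := pin_of_freshGate I hI hT hS hB hF he hpe hne hclean halone₂ ht
  obtain ⟨hne0, hX, hJr, hdj₁, hdj₂, hr, hT3, hM0⟩ := ht
  -- name the other AND variable of `e`
  obtain ⟨p', hpp⟩ : ∃ p', (I.vars e 2 = p ∧ I.vars e 3 = p') ∨ (I.vars e 2 = p' ∧ I.vars e 3 = p) := by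
    rcases hpe with h | h
    · exact ⟨_, Or.inl ⟨h, rfl⟩⟩
    · exact ⟨_, Or.inr ⟨rfl, h⟩⟩
  have hne' : p ≠ p' := by
    rcases hpp with ⟨h2, h3⟩ | ⟨h2, h3⟩
    · rw [← h2, ← h3]; exact hne
    · rw [← h2, ← h3]; exact hne.symm
  -- `q ∈ {p, p'}`: in `varSet e`, on the boundary, untouched by the remaining monomials
  have h1 : ∀ g' ∈ w₁.2.1.erase g, (I.vars g' 2 ≠ I.vars e 2 ∧ I.vars g' 3 ≠ I.vars e 2) ∧
      (I.vars g' 2 ≠ I.vars e 3 ∧ I.vars g' 3 ≠ I.vars e 3) := by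
    intro g' hg'
    have h := halone g' (mem_union_left _ (mem_of_mem_erase hg')) (ne_of_mem_erase hg')
    exact ⟨⟨(h 2 (by decide)).1, (h 3 (by decide)).1⟩, ⟨(h 2 (by decide)).2, (h 3 (by decide)).2⟩⟩
  have h2 : ∀ g' ∈ w₂.2.1, (I.vars g' 2 ≠ I.vars e 2 ∧ I.vars g' 3 ≠ I.vars e 2) ∧
      (I.vars g' 2 ≠ I.vars e 3 ∧ I.vars g' 3 ≠ I.vars e 3) := by
    intro g' hg'
    have h := halone₂ g' hg'
    exact ⟨⟨(h 2 (by decide)).1, (h 3 (by decide)).1⟩, ⟨(h 2 (by decide)).2, (h 3 (by decide)).2⟩⟩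
  have hq : ∀ q, q = p ∨ q = p' → q ∈ varSet I e ∧ q ∈ bdry I J₀ ∧
      (∀ g' ∈ w₁.2.1.erase g, I.vars g' 2 ≠ q ∧ I.vars g' 3 ≠ q) ∧ (∀ g' ∈ w₂.2.1, I.vars g' 2 ≠ q ∧ I.vars g' 3 ≠ q) := by
    intro q hq
    have hcase : I.vars e 2 = q ∨ I.vars e 3 = q := by
      rcases hpp with ⟨h2', h3'⟩ | ⟨h2', h3'⟩ <;> rcases hq with rfl | rfl
      exacts [Or.inl h2', Or.inr h3', Or.inr h3', Or.inl h2']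
    rcases hcase with hsq | hsq <;> subst hsq
    · exact ⟨vars_mem_varSet I e 2, hclean.1, fun g' hg' => (h1 g' hg').1, fun g' hg' => (h2 g' hg').1⟩
    · exact ⟨vars_mem_varSet I e 3, hclean.2, fun g' hg' => (h1 g' hg').2, fun g' hg' => (h2 g' hg').2⟩
  -- flipping a private keeps `Sol(J₀ ∖ e)` and moves `(w₁′, w₂)` by its linear coefficients
  have hflipSol : ∀ q, q = p ∨ q = p' → ∀ x : Fin n → Bool, (∀ j ∈ J₀.erase e, I.eval x j = y j) → ∀ b,
      ∀ j ∈ J₀.erase e, I.eval (Function.update x q b) j = y j := by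
    intro q hq' x hx b j hj
    obtain ⟨hqv, hqb, -, -⟩ := hq q hq'
    rw [eval_update_of_not_mem I j x (not_mem_varSet_of_private I he (mem_of_mem_erase hj) (ne_of_mem_erase hj) hqb hqv) b]
    exact hx j hj
  have hflipA : ∀ q, q = p ∨ q = p' → ∀ (x : Fin n → Bool) (b : Bool),
      bit (gval I w₁.1 (w₁.2.1.erase g) (Function.update x q b)) =
        bit (gval I w₁.1 (w₁.2.1.erase g) x) + if q ∈ w₁.1 then bit b + bit (x q) else 0 :=
    fun q hq' x b => bit_gval_update_lin I w₁.1 x (hq q hq').2.2.1 b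
  have hflipW : ∀ q, q = p ∨ q = p' → ∀ (x : Fin n → Bool) (b : Bool),
      bit (gval I w₂.1 w₂.2.1 (Function.update x q b)) = bit (gval I w₂.1 w₂.2.1 x) + if q ∈ w₂.1 then bit b + bit (x q) else 0 :=
    fun q hq' x b => bit_gval_update_lin I w₂.1 x (hq q hq').2.2.2 b
  -- gate-off witnesses of the other outputs
  have hM0' : ∀ f ∈ J₀, f ≠ e → ∃ x : Fin n → Bool, (∀ j ∈ J₀.erase f, I.eval x j = y j) ∧
      gval I w₁.1 (w₁.2.1.erase g) x = w₁.2.2 ∧ gval I w₂.1 w₂.2.1 x = w₂.2.2 := by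
    intro f hf hfe
    obtain ⟨x, hx, h1x, h2x⟩ := hM0 f hf
    have hp0 : x p = false := hpin x (hx e (mem_erase.2 ⟨hfe.symm, he⟩)) h2x
    refine ⟨x, hx, ?_, h2x⟩
    apply bit_injective
    have h := hF.bit_gval₁ x
    rw [hp0, h1x] at h
    have e1 : ∀ a c d : ZMod 2, a = c + bit false * d → c = a := by decide
    exact e1 _ _ _ h
  refine ⟨hne0, hX, hJr, hdj₁.mono_right (erase_subset g _), hdj₂,
    (card_le_card (union_subset_union (union_subset_union (Subset.refl J₀) (erase_subset g _)) (Subset.refl _))).trans hr,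
    ((t3_fresh_split I y hF).1 hT3).1, fun f hf => ?_⟩
  show ∃ x : Fin n → Bool, (∀ j ∈ J₀.erase f, I.eval x j = y j) ∧ gval I w₁.1 (w₁.2.1.erase g) x = w₁.2.2 ∧
    gval I w₂.1 w₂.2.1 x = w₂.2.2
  by_cases hfe : f = e
  swap
  · exact hM0' f hf hfe
  subst hfe
  -- (M0) at `e`
  by_contra hgoal
  obtain ⟨x₁, hx₁, hw₁, hW₁⟩ := hM0 f hf
  -- the original witness has `w₁′ x₁ ≠ t₁` (else it is a witness)
  have hA₁ : gval I w₁.1 (w₁.2.1.erase g) x₁ ≠ w₁.2.2 := fun h => hgoal ⟨x₁, hx₁, h, hW₁⟩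
  -- another output and its gate-off witness
  obtain ⟨f', hf', hf'e⟩ := exists_ne_of_xorClosed I hX hf
  obtain ⟨x₂, -, hA₂, hW₂⟩ := hM0' f' hf' hf'e
  have hJr' : (J₀.erase f).card ≤ r := (card_le_card (erase_subset f J₀)).trans hJr.le
  have eflip : ∀ a t c : Bool, a ≠ t → bit a + (bit (!c) + bit c) = bit t := by decide
  by_cases hC₂ : p ∈ w₂.1 ∨ p' ∈ w₂.1
  · -- a private `q` read by `w₂`
    obtain ⟨q, hq', hqC₂⟩ : ∃ q, (q = p ∨ q = p') ∧ q ∈ w₂.1 := by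
      rcases hC₂ with h | h
      · exact ⟨p, Or.inl rfl, h⟩
      · exact ⟨p', Or.inr rfl, h⟩
    by_cases hqC₁ : q ∈ w₁.1
    · -- flipping `q` toggles both: `w₁′ + w₂` misses `t₁ + t₂` on `Sol(J₀ ∖ e)`
      have hmiss : ∀ x : Fin n → Bool, (∀ j ∈ J₀.erase f, I.eval x j = y j) →
          gval I (w₁.1 ∆ w₂.1) ((w₁.2.1.erase g) ∆ w₂.2.1) x ≠ xor w₁.2.2 w₂.2.2 := by
        intro x hx hval
        rw [gval_symmDiff] at hval
        by_cases hAx : gval I w₁.1 (w₁.2.1.erase g) x = w₁.2.2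
        · rw [hAx] at hval
          have e2 : ∀ a s t : Bool, xor a s = xor a t → s = t := by decide
          exact hgoal ⟨x, hx, hAx, e2 _ _ _ hval⟩
        · have hWx : gval I w₂.1 w₂.2.1 x ≠ w₂.2.2 := by
            intro hWx
            rw [hWx] at hval
            apply hAx
            have e2 : ∀ a t s : Bool, xor a s = xor t s → a = t := by decide
            exact e2 _ _ _ hval
          refine hgoal ⟨Function.update x q (!x q), hflipSol q hq' x hx _, ?_, ?_⟩
          · apply bit_injective
            rw [hflipA q hq' x (!x q), if_pos hqC₁]
            exact eflip _ _ _ hAx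
          · apply bit_injective
            rw [hflipW q hq' x (!x q), if_pos hqC₂]
            exact eflip _ _ _ hWx
      -- so `w₁′ + w₂` is constant (gSat) — but it differs at `x₁` and `x₂`
      have hdisj : Disjoint (J₀.erase f) ((w₁.2.1.erase g) ∆ w₂.2.1) := by
        refine Disjoint.mono (erase_subset f J₀) ?_ (disjoint_union_right.2 ⟨hdj₁, hdj₂⟩)
        exact (symmDiff_le_sup (a := w₁.2.1.erase g) (b := w₂.2.1)).trans (union_subset_union (erase_subset g _) (Subset.refl _))
      have hnc : ∃ x x' : Fin n → Bool, gval I (w₁.1 ∆ w₂.1) ((w₁.2.1.erase g) ∆ w₂.2.1) x ≠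
          gval I (w₁.1 ∆ w₂.1) ((w₁.2.1.erase g) ∆ w₂.2.1) x' := by
        refine ⟨x₁, x₂, ?_⟩
        rw [gval_symmDiff, gval_symmDiff, hA₂, hW₂, hW₁]
        have e1 : ∀ a t s : Bool, a ≠ t → xor a s ≠ xor t s := by decide
        exact e1 _ _ _ hA₁
      obtain ⟨x, hx, hval⟩ := gSat n m r I hI hT hB hS y (J₀.erase f) _ _ (xor w₁.2.2 w₂.2.2) hJr' hdisj hnc
      exact hmiss x hx hval
    · -- flipping `q` toggles `w₂` only: `w₁′` misses `t₁` on `Sol(J₀ ∖ e)`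
      have hmiss : ∀ x : Fin n → Bool, (∀ j ∈ J₀.erase f, I.eval x j = y j) → gval I w₁.1 (w₁.2.1.erase g) x ≠ w₁.2.2 := by
        intro x hx hAx
        by_cases hWx : gval I w₂.1 w₂.2.1 x = w₂.2.2
        · exact hgoal ⟨x, hx, hAx, hWx⟩
        · refine hgoal ⟨Function.update x q (!x q), hflipSol q hq' x hx _, ?_, ?_⟩
          · apply bit_injective
            rw [hflipA q hq' x (!x q), if_neg hqC₁, add_zero, hAx]
          · apply bit_injective
            rw [hflipW q hq' x (!x q), if_pos hqC₂]
            exact eflip _ _ _ hWx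
      have hnc : ∃ x x' : Fin n → Bool, gval I w₁.1 (w₁.2.1.erase g) x ≠ gval I w₁.1 (w₁.2.1.erase g) x' :=
        ⟨x₂, x₁, by rw [hA₂]; exact fun h => hA₁ h.symm⟩
      obtain ⟨x, hx, hval⟩ := gSat n m r I hI hT hB hS y (J₀.erase f) _ _ w₁.2.2 hJr'
        (hdj₁.mono (erase_subset f J₀) (erase_subset g _)) hnc
      exact hmiss x hx hval
  · -- no private of `e` is read by `w₂`: the lifted witness contradicts the pin
    rw [not_or] at hC₂
    have hG₂ : ∀ g' ∈ w₂.2.1, (I.vars g' 2 ≠ p ∧ I.vars g' 3 ≠ p) ∧ (I.vars g' 2 ≠ p' ∧ I.vars g' 3 ≠ p') :=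
      fun g' hg' => ⟨(hq p (Or.inl rfl)).2.2.2 g' hg', (hq p' (Or.inr rfl)).2.2.2 g' hg'⟩
    have hliftC : liftC I f p p' w₂.1 = w₂.1 := by
      unfold liftC
      rw [if_neg hC₂.2, erase_eq_of_notMem (fun h => hC₂.2 (mem_of_mem_erase h)), erase_eq_of_notMem hC₂.1]
      exact symmDiff_bot _
    have hliftc : liftc w₂.1 p p' y f = 0 := by
      unfold liftc
      rw [if_neg hC₂.1, if_neg hC₂.2, add_zero]
    have hWlift : gval I w₂.1 w₂.2.1 (lift I y f p p' x₁) = w₂.2.2 := by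
      apply bit_injective
      rw [bit_gval_lift hI hpp hne' y w₂.1 hG₂ x₁, hliftC, hliftc, add_zero, hW₁]
    have h := hpin (lift I y f p p' x₁) (eval_lift hI hpp hne' y x₁) hWlift
    rw [lift_p hne'] at h
    exact Bool.noConfusion h

end Summit.PneNP.PneNP.Theorems.PstarFreshEraseTerminal
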